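import Summits.KontsevichZagierPeriods.Zeta5Search.LaiSweepShard

/-!
# `κ₃` sweep certificate — shard file 094 of 127 (shards 658–664 of 889)

HONEST FRAMING. Systematic search; no irrationality claim unless certified. This file only checks,
by `decide +kernel`, shards 658–664 of the order-cell sweep of the `κ₃` point `(74, 2180, 444; δ74)`
(engine `LaiSweepEngine`, soundness `LaiSweepJump/Free/Eval/Shard/Kappa3`; a shard is `⟨regime, n,
p, q, p', q', Lo, Up⟩`: `n` cells from `p/q` to `p'/q'` with integer rate sums in `[Lo, Up]`, `K =
128`, `D = 2^40`). It draws NO conclusion: only the capstone `LaiKappa3SweepCert`, which needs all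
127 shard files, does. Kernel cost of this file ≈ 560 cells × 0.3 s.
-/

namespace Summit.KontsevichZagierPeriods.Zeta5Search.Sweep

set_option maxHeartbeats 100000000 in
/-- Shard 658: 80 cells of regime B from `181/255` to `187/263`.
[cite: Lai2024BallRivoal, §4 Lemma 4.3] -/
theorem shard658 :
    Shard.check 128 (2^40)
      ⟨true, 80, 181, 255, 187, 263, 11608200636269, 16741933036698⟩ = true := by
  decide +kernel

set_option maxHeartbeats 100000000 in
/-- Shard 659: 80 cells of regime B from `187/263` to `255/358`.
[cite: Lai2024BallRivoal, §4 Lemma 4.3] -/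
theorem shard659 :
    Shard.check 128 (2^40)
      ⟨true, 80, 187, 263, 255, 358, 11987518082222, 17306966292712⟩ = true := by
  decide +kernel

set_option maxHeartbeats 100000000 in
/-- Shard 660: 80 cells of regime B from `255/358` to `269/377`.
[cite: Lai2024BallRivoal, §4 Lemma 4.3] -/
theorem shard660 :
    Shard.check 128 (2^40)
      ⟨true, 80, 255, 358, 269, 377, 11721132276504, 16940014627452⟩ = true := by
  decide +kernel

set_option maxHeartbeats 100000000 in
/-- Shard 661: 80 cells of regime B from `269/377` to `158/221`.
[cite: Lai2024BallRivoal, §4 Lemma 4.3] -/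
theorem shard661 :
    Shard.check 128 (2^40)
      ⟨true, 80, 269, 377, 158, 221, 13278846401443, 19213359751693⟩ = true := by
  decide +kernel

set_option maxHeartbeats 100000000 in
/-- Shard 662: 80 cells of regime B from `158/221` to `169/236`.
[cite: Lai2024BallRivoal, §4 Lemma 4.3] -/
theorem shard662 :
    Shard.check 128 (2^40)
      ⟨true, 80, 158, 221, 169, 236, 11057732557711, 16016071671248⟩ = true := by
  decide +kernel

set_option maxHeartbeats 100000000 in
/-- Shard 663: 80 cells of regime B from `169/236` to `269/375`.
[cite: Lai2024BallRivoal, §4 Lemma 4.3] -/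
theorem shard663 :
    Shard.check 128 (2^40)
      ⟨true, 80, 169, 236, 269, 375, 11632228224970, 16865123591801⟩ = true := by
  decide +kernel

set_option maxHeartbeats 100000000 in
/-- Shard 664: 80 cells of regime B from `269/375` to `143/199`.
[cite: Lai2024BallRivoal, §4 Lemma 4.3] -/
theorem shard664 :
    Shard.check 128 (2^40)
      ⟨true, 80, 269, 375, 143, 199, 11880609050765, 17243215198519⟩ = true := by
  decide +kernel

/-- The checked shards of this file, in order. [folklore] -/
def shards094 : List (CheckedShard 128 (2^40)) :=
  [⟨_, shard658⟩, ⟨_, shard659⟩, ⟨_, shard660⟩, ⟨_, shard661⟩, ⟨_, shard662⟩,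
    ⟨_, shard663⟩, ⟨_, shard664⟩]

end Summit.KontsevichZagierPeriods.Zeta5Search.Sweep
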